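import Literature.Probability.Percolation.TriCorrLengthExponentFromFacts
import Literature.Probability.Percolation.KestenScalingFromSeparation
import Literature.Probability.Percolation.TriThetaExponentFromSeparation
import HarnessLib

/-!
# `ξ(p) = |p - 1/2|^{-4/3 + o(1)}` from the four-arm exponent and near-critical four-arm separation (assembly, proofs only)

Topic `Literature/Probability/Percolation`; family `crit-perc`. PROOFS ONLY (no definition, no
named fact): the current state of the discharge of the named fact
`Literature.Probability.Percolation.triCorrLength_exponent` (`ArmExponents.lean`; S. Smirnov,
W. Werner, *Critical exponents for two-dimensional percolation*, Math. Res. Lett. 8 (2001)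
729–744, Thm. 1 (iii)–(iv) of the arXiv text `math/0109120`, p. 3, and the paragraph following
Thm. 1, p. 4: "It has been shown by Kesten [13] that all these results hold provided that
`P[A¹_R] = R^{-5/48+o(1)}` and `P[A²_R] = R^{-5/4+o(1)}`").

The tree proves `ν = 4/3` from the four-arm exponent and Kesten's scaling relation at Nolin's
characteristic length, `triCorrLength_exponent_of_prop34 : fourArm_exponent → Nolin2008_prop34 →
triCorrLength_exponent` (`TriCorrLengthExponentFromFacts.lean`: the Russo–Seymour–Welsh theory
below `L_ε(p)`, the exponential decay beyond it and `ξ ≍ L_ε` are theorems of the tree), and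
Kesten's relation is now a theorem conditional on ONE explicit hypothesis, near-critical
four-arm separation below Werner's length `L(p, ε)` — `c · π̂_t(n, N) ≤ P_t(sepFourArm n N)` for
`n₀ ≤ n`, `2n ≤ N`, `N ≤ L(t, ε)` if `t > 1/2`, `t ∈ [1/2, 1/2 + δ)` (Nolin 2008, Thm. 11
[arXiv 0711.4948: Thm. 10] for `j = 4`, after Kesten 1987, Lemmas 4–6) —
`Nolin2008_prop34_of_separation` (`KestenScalingFromSeparation.lean`, through
`Werner2009_fourArm_quasiMult_of_separation` and `Werner2009_pivotal_lowerBound_of_separation`).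
The same hypothesis contains, at `t = 1/2`, the critical separation consumed by Smirnov–Werner's
Thm. 4 for `j = 4` (`fourArm_exponent_of_scalingLimit_of_nearCritical_separation`,
`TriThetaExponentFromSeparation.lean`). Hence (this file):

* `triCorrLength_exponent_of_separation` : **`fourArm_exponent →` (near-critical four-arm
  separation) `→ triCorrLength_exponent`**;
* `triCorrLength_exponent_of_scalingLimit_of_separation` : **what `triCorrLength_exponent_holds`
  still needs, exactly** — the scaling limit of the critical four-arm probabilities
  `π₄(ρ r, ρ R) → L(r, R)` (SW (16), `j = 4`: Smirnov's theorem / Camia–Newman), its `SLE₆`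
  exponent `log L(1, n) / log n → -5/4` (SW (9) with (15), Lawler–Schramm–Werner), and
  near-critical four-arm separation (Nolin's Thm. 11, `j = 4`, the live `ArmSeparation*.lean`
  programme). Every discrete step of the printed proof of SW Thm. 1 (iii)–(iv) other than the
  separation theorem is supplied by the tree.

## References

* S. Smirnov, W. Werner, Critical exponents for two-dimensional percolation, *Math. Res. Lett.*
  8 (2001) 729–744, Thm. 1 (iii)–(iv), the paragraph following Thm. 1, Thm. 4 and §4 (9), (10),
  (15), (16) (arXiv math/0109120) [SmirnovWernerMRL2001].
* H. Kesten, Scaling relations for 2D-percolation, *Comm. Math. Phys.* 109 (1987) 109–156,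
  (4.5), Cor. 1–2, Lemmas 4–6 [KestenScalingCMP1987].
* P. Nolin, Near-critical percolation in two dimensions, *Electron. J. Probab.* 13 (2008), Thm. 11,
  §7.2 Thm. 31, §7.3 Prop. 34, §7.4 Lemma 39 (arXiv 0711.4948: Thm. 10, Prop. 32, Lemma 37) [Nolin2008].
* W. Werner, *Lectures on two-dimensional critical percolation*, IAS/Park City Math. Ser. 16
  (2009), Lecture 6, Prop. 6.1, Cor. 6.2, Lemma 6.2, Lemma 6.3 [WernerPCMI2009].

Tree: `triCorrLength_exponent_of_prop34` (`TriCorrLengthExponentFromFacts.lean`),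
`Nolin2008_prop34_of_separation` (`KestenScalingFromSeparation.lean`),
`fourArm_exponent_of_scalingLimit_of_nearCritical_separation`
(`TriThetaExponentFromSeparation.lean`). Mathlib: nothing beyond the imports of these files.
-/

noncomputable section

open Filter
open scoped Topology unitInterval

namespace Literature.Probability.Percolation

open LatticeModels

/-- **`ν = 4/3` from the four-arm exponent and near-critical four-arm separation**
(Smirnov–Werner 2001, Thm. 1 (iii)–(iv): `ξ(p) = |p - 1/2|^{-4/3+o(1)}` as `p → 1/2`, via
Kesten's relation `|p - 1/2| L_ε(p)² π₄(L_ε(p)) ≍ 1`, here `Nolin2008_prop34_of_separation`):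
IF the four-arm exponent is `5/4` and the well-separated alternating four-arm event is
comparable to the four-arm event uniformly below `L(p)` (Nolin 2008, Thm. 11, `j = 4`), THEN
`triCorrLength_exponent`. [cite: SmirnovWernerMRL2001, Thm. 1 (iii)–(iv) and the paragraph following Thm. 1 (arXiv math/0109120, pp. 3–4)] [cite: Nolin2008, Thm. 11, §7.3 Prop. 34, §7.4 Lemma 39 (arXiv 0711.4948: Thm. 10, Prop. 32, Lemma 37)] [cite: KestenScalingCMP1987, (4.5) and Cor. 1–2] -/
theorem triCorrLength_exponent_of_separation (h₄ : fourArm_exponent)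
    (hsep : ∃ ε₁ > (0 : ℝ), ∀ ⦃ε : ℝ⦄, 0 < ε → ε < ε₁ →
      ∃ n₀ : ℕ, ∃ δ > (0 : ℝ), ∃ c > (0 : ℝ),
        ∀ t : unitInterval, 1 / 2 ≤ (t : ℝ) → (t : ℝ) < 1 / 2 + δ →
          ∀ n N : ℕ, n₀ ≤ n → 2 * n ≤ N → (1 / 2 < (t : ℝ) → N ≤ charLengthW ε t) →
            c * fourArmProbAt t n N ≤ (triSitePercolation t).real (sepFourArm n N)) :
    triCorrLength_exponent :=
  triCorrLength_exponent_of_prop34 h₄ (Nolin2008_prop34_of_separation hsep)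

/-- **What `triCorrLength_exponent_holds` still needs, exactly** (Smirnov–Werner 2001,
Thm. 1 (iii)–(iv) with Thm. 4 for `j = 4`): IF the critical four-arm probabilities have the
scaling limit `π₄(ρ r, ρ R) → L(r, R)` as `ρ → ∞` for all integers `1 ≤ r < R` (SW (16):
Smirnov's theorem / the full scaling limit), `log L(1, n) / log n → -5/4` (SW (9) with (15): the
`SLE₆` exponent `(4² - 1)/12` of Lawler–Schramm–Werner), and near-critical four-arm separation
below `L(p)` holds (Nolin 2008, Thm. 11, `j = 4`; Kesten 1987, Lemmas 4–6), THEN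
`ξ(p) = |p - 1/2|^{-4/3+o(1)}` as `p → 1/2`:
`triCorrLength_exponent_of_separation` with
`fourArm_exponent_of_scalingLimit_of_nearCritical_separation`. [cite: SmirnovWernerMRL2001, Thm. 1 (iii)–(iv), Thm. 4 (j = 4), §4 (9), (10), (15), (16)] [cite: Nolin2008, Thm. 11 and Prop. 17 (arXiv 0711.4948: Thm. 10, Prop. 16)] [cite: KestenScalingCMP1987, (4.5) and Cor. 1–2] -/
theorem triCorrLength_exponent_of_scalingLimit_of_separation (L : ℕ → ℕ → ℝ)
    (hlim : ∀ r R : ℕ, 1 ≤ r → r < R →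
      Tendsto (fun ρ : ℕ => critFourArmProb (ρ * r) (ρ * R)) atTop (𝓝 (L r R)))
    (hexp : Tendsto (fun n : ℕ => Real.log (L 1 n) / Real.log n) atTop (𝓝 (-(5 / 4))))
    (hsep : ∃ ε₁ > (0 : ℝ), ∀ ⦃ε : ℝ⦄, 0 < ε → ε < ε₁ →
      ∃ n₀ : ℕ, ∃ δ > (0 : ℝ), ∃ c > (0 : ℝ),
        ∀ t : unitInterval, 1 / 2 ≤ (t : ℝ) → (t : ℝ) < 1 / 2 + δ →
          ∀ n N : ℕ, n₀ ≤ n → 2 * n ≤ N → (1 / 2 < (t : ℝ) → N ≤ charLengthW ε t) →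
            c * fourArmProbAt t n N ≤ (triSitePercolation t).real (sepFourArm n N)) :
    triCorrLength_exponent :=
  triCorrLength_exponent_of_separation
    (fourArm_exponent_of_scalingLimit_of_nearCritical_separation L hlim hexp hsep) hsep

end Literature.Probability.Percolation

end
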